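import Summits.Langlands.Langlands.Theorems.IrreducibilityBySelfDualityPairLBoundaryJS
import Summits.Langlands.Langlands.Theorems.IrreducibilityBySelfDualityPairLBoundaryJSSsv
import Summits.Langlands.Langlands.Theorems.IrreducibilityBySelfDualityPairLBoundaryJSStandardEntire
import Summits.Langlands.Langlands.Theorems.IrreducibilityBySelfDualityPairLBoundaryJSIsOrthoOfLocalTranslate
import Summits.Langlands.Langlands.Theorems.IrreducibilityBySelfDualityPairLBoundaryJSEqConjOfLocalTranslate
import Summits.Langlands.Langlands.Theorems.IrreducibilityBySelfDualityPairLBoundaryJSLocalPairTranslate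
import Summits.Langlands.Langlands.Theorems.IrreducibilityBySelfDualityPairLBoundaryJSOfHumphriesJo
import Literature.NumberTheory.Automorphic.PairLFunctionMeromorphicContinuationRankNeTwistProofs
import Literature.NumberTheory.Automorphic.ArchRankinSelbergTestVector
import Literature.NumberTheory.Automorphic.JPSSGlobalIntegralQuotientUnfolding
import Literature.NumberTheory.Automorphic.JPSSCornerWhittakerUnfolding
import Literature.NumberTheory.Automorphic.WhittakerPeriodExchange
import Literature.NumberTheory.Automorphic.TorusIwasawaTransport
import Literature.NumberTheory.Automorphic.CornerTorusIwasawaData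
import Literature.NumberTheory.Automorphic.WhittakerCoeffHonestCuspForm
import Literature.NumberTheory.Automorphic.WhittakerCoeffTranslateUnramified
import Literature.NumberTheory.Automorphic.WhittakerDecayCuspForm
import Literature.NumberTheory.Automorphic.WhittakerSupportFinite
import Literature.NumberTheory.Automorphic.RankinSelbergUnramifiedTorus
import Literature.NumberTheory.Automorphic.RankinSelbergTorusPairEuler
import Literature.NumberTheory.Automorphic.RankinSelbergTowerFiniteness

/-!
# The gauge majorant of `W_φ` at the corner torus points `diag(diag(a) k, 1)`

Summit `Langlands`, sub-problem `Langlands`, helper file under `Theorems/` supporting the crux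
`PairLBoundaryJS` (stmt-Langlands-13622), line `Sketch`, registered stub `stub_corner_abs_convergence` (W-Ac),
part 1 of 4 (the pointwise majorant; parts 2–3: the torus integral of the majorant is finite,
`…CornerAbsIdeleMoment`, `…CornerAbsTorusMajorant`; part 4: the stub, `…CornerAbsConvergence`). For an
`A_G`-invariant honest cusp form `φ` on `GL_{m+1}(𝔸_K)` and its global Whittaker function
`W_φ = whittakerDepth 0 φ`, at the torus points of the unfolded `GL_{m+1} × GL_m` integral
(Cogdell (2004), §2.3 "the gauge estimates"; Jacquet–Piatetski-Shapiro–Shalika (1983), §2):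

* `valued_le_pow_of_whittakerDepth_glCorner_ne_zero` — **finite support**: `W_φ(diag(diag(a)k,1)) ≠ 0` forces
  `|a_{l,v}|_v ≤ B_v^{m-l}` (the simple-root support condition `valued_lt_of_whittakerDepth_zero_ne_zero` at the
  finite Iwasawa data `sndHom_glCorner_torusPoint`, chained down from the last root, whose second entry is `1`);
* `norm_whittakerDepth_glCorner_mul_pow_le`, `…_mul_prod_pow_le` — **archimedean decay** in every coordinate
  `a_l` at every infinite place, uniformly in `k` (the telescoped decay
  `exists_norm_whittakerDepth_zero_mul_pow_le` at the archimedean Iwasawa data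
  `exists_toMixed_glCorner_torusPoint`, radii `‖a_{i,w}‖` and `1`), and the product form
  `‖W_φ‖ (∏_{l,w} max(1, ‖a_{l,w}‖))^M ≤ C`;
* `corner_majorant` / `stub_corner_majorant` — the assembled majorant
  `‖W_φ(diag(diag(a)k,1))‖ ≤ C ∏_{l,w} min(1, ‖a_{l,w}‖^{-M})`, supported in `{|a_{l,v}|_v ≤ R_v}`, `R_v = 1` a.e.

## References

* J. W. Cogdell, *Analytic theory of L-functions for GL_n*, in *An Introduction to the Langlands
  Program* (2004), Thm. 1.1, §2.3 [CogdellAnalyticTheory2004].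
-/

noncomputable section

-- `Summit.Langlands.Langlands.…` (summit = sub-problem name, D-0017 layout) trips `dupNamespace`
set_option linter.dupNamespace false

open scoped MatrixGroups Topology Pointwise ENNReal NNReal ComplexConjugate InnerProductSpace ContDiff
-- the place subtypes indexing `mixedSpace K` are `Fintype` classically (`NormedCommRing (mixedSpace K)`)
open scoped Classical Matrix.Norms.Operator
open NumberField IsDedekindDomain MeasureTheory Measure Matrix Set Filter WithZero
open NumberField.mixedEmbedding
open Literature.NumberTheory.Automorphic AdelicGroupData
open Literature.NumberTheory.GaloisRepresentations (ideleGroup HeckeCharacter)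
open Literature.MeasureTheory.Group
open Literature.RingTheory.SymmetricFunctions.SymmPoly
open ValuativeRel

-- the automorphic quotient carries the tree's Borel σ-algebra, not Mathlib's quotient σ-algebra
attribute [-instance] Quotient.instMeasurableSpace QuotientGroup.measurableSpace

-- the house local instances, exactly as in `RankinSelbergUnfoldingIdentity`
attribute [local instance] adelicBorel borelSpace_adelic locallyCompactSpace_adelic secondCountableTopology_gl_adelic
  glAdeleBorel borelSpace_glAdele borelSpace_ideleGroup secondCountableTopology_ideleGroup

-- Mathlib idiom: the commutator Lie ring on matrices, to mention `(archGroupGL n K).lie`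
attribute [local instance 100] LieRing.ofAssociativeRing


namespace Summit.Langlands.Langlands.Theorems.CornerAbsMajorant

variable {m : ℕ} {K : Type} [Field K] [NumberField K]

/-! ### Finite support of `W_φ` at the corner torus points -/

/-- **Finite support at the corner torus points.** Let `φ` on `GL_{m+1}(𝔸_K)` be left `GL_{m+1}(K)`-invariant
and right `K(𝔫)`-invariant, and let `B_v` be bounds such that `a |𝔫|_v < |x|_v b` for all `x` with
`ψ_v(x) ≠ 1` forces `a ≤ B_v b` (`exists_finset_bound_adeleAddCharAt`). If
`W_φ(diag(diag(a) k, 1)) ≠ 0` then `|a_{l,v}|_v ≤ B_v^{m-l}` for every finite place `v` and every `l < m`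
(the simple-root support condition `valued_lt_of_whittakerDepth_zero_ne_zero` at the finite Iwasawa data
`diag(snoc a_f 1) diag(k_f, 1)` of the corner point, `sndHom_glCorner_torusPoint`, chained down from the
last simple root, whose second entry is `1`). [cite: CogdellAnalyticTheory2004, Thm. 1.1 and §2.3] -/
theorem valued_le_pow_of_whittakerDepth_glCorner_ne_zero {φ : GL (Fin (m + 1)) (AdeleRing (𝓞 K) K) → ℂ}
    (hφK : ∀ (γ₀ : GL (Fin (m + 1)) K) (x : GL (Fin (m + 1)) (AdeleRing (𝓞 K) K)),
      φ (Matrix.GeneralLinearGroup.map (algebraMap K (AdeleRing (𝓞 K) K)) γ₀ * x) = φ x)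
    {𝔫 : Ideal (𝓞 K)} (hφU : ∀ x, ∀ u ∈ principalCongruenceLevel (m + 1) K 𝔫, φ (x * u) = φ x)
    {B : HeightOneSpectrum (𝓞 K) → WithZero (Multiplicative ℤ)}
    (hB : ∀ (v : HeightOneSpectrum (𝓞 K)) (a b : WithZero (Multiplicative ℤ)),
      (∀ x : v.adicCompletion K, adeleAddCharAt K v x ≠ 1 → a * idealRadius K v 𝔫 < Valued.v x * b) → a ≤ B v * b)
    {a : Fin m → ideleGroup K} {k : ↥(maximalCompactAdelic m K)}
    (hW : whittakerDepth 0 φ (glCorner (AdeleRing (𝓞 K) K) (Nat.le_succ m) (torusPoint m K (a, k))) ≠ 0)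
    (v : HeightOneSpectrum (𝓞 K)) (l : Fin m) :
    Valued.v (((a l : ideleGroup K) : AdeleRing (𝓞 K) K).2 v) ≤ B v ^ (m - l) := by
  obtain ⟨hsnd, hk⟩ := sndHom_glCorner_torusPoint a k.2
  set t : Fin (m + 1) → (FiniteAdeleRing (𝓞 K) K)ˣ :=
    Fin.snoc (fun i => Units.map (RingHom.snd (InfiniteAdeleRing K) (FiniteAdeleRing (𝓞 K) K)).toMonoidHom (a i)) 1
    with ht
  have hW' : whittakerDepth 0 φ (glCorner (AdeleRing (𝓞 K) K) (Nat.le_succ m)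
      (glDiagonal m (AdeleRing (𝓞 K) K) a * (show GL (Fin m) (AdeleRing (𝓞 K) K) from
        ((k : ↥(maximalCompactAdelic m K)) : (AdelicGroupData.gl m K).Adelic)))) ≠ 0 := hW
  have hstep : ∀ (j : ℕ) (hj : j + 1 < m + 1),
      Valued.v (((t ⟨j, by omega⟩ : (FiniteAdeleRing (𝓞 K) K)ˣ) : FiniteAdeleRing (𝓞 K) K) v) ≤
        B v * Valued.v (((t ⟨j + 1, hj⟩ : (FiniteAdeleRing (𝓞 K) K)ˣ) : FiniteAdeleRing (𝓞 K) K) v) :=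
    fun j hj => hB v _ _ fun x hx => valued_lt_of_whittakerDepth_zero_ne_zero hφK hφU hk hsnd hW' v hj hx
  have ht_cast : ∀ i : Fin m, ((t (Fin.castSucc i) : (FiniteAdeleRing (𝓞 K) K)ˣ) : FiniteAdeleRing (𝓞 K) K) v =
      ((a i : ideleGroup K) : AdeleRing (𝓞 K) K).2 v := by
    intro i; rw [ht, Fin.snoc_castSucc]; rfl
  have ht_last : ((t (Fin.last m) : (FiniteAdeleRing (𝓞 K) K)ˣ) : FiniteAdeleRing (𝓞 K) K) v = 1 := by
    rw [ht, Fin.snoc_last]; rfl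
  have hchain : ∀ (d : ℕ) (l : Fin m), (l : ℕ) + d + 1 = m →
      Valued.v (((a l : ideleGroup K) : AdeleRing (𝓞 K) K).2 v) ≤ B v ^ (d + 1) := by
    intro d
    induction d with
    | zero =>
      intro l hl
      have h := hstep l (by omega)
      have e1 : (⟨(l : ℕ), by omega⟩ : Fin (m + 1)) = Fin.castSucc l := Fin.ext rfl
      have e2 : (⟨(l : ℕ) + 1, by omega⟩ : Fin (m + 1)) = Fin.last m := Fin.ext (by simp only [Fin.val_last]; omega)
      rw [e1, e2, ht_cast, ht_last, map_one, mul_one] at h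
      rwa [zero_add, pow_one]
    | succ d ih =>
      intro l hl
      have hl1 : (l : ℕ) + 1 < m := by omega
      have h := hstep l (by omega)
      have e1 : (⟨(l : ℕ), by omega⟩ : Fin (m + 1)) = Fin.castSucc l := Fin.ext rfl
      have e2 : (⟨(l : ℕ) + 1, by omega⟩ : Fin (m + 1)) = Fin.castSucc ⟨(l : ℕ) + 1, hl1⟩ := Fin.ext rfl
      rw [e1, e2, ht_cast, ht_cast] at h
      have h2 := ih ⟨(l : ℕ) + 1, hl1⟩ (by simp only; omega)
      calc Valued.v (((a l : ideleGroup K) : AdeleRing (𝓞 K) K).2 v)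
          ≤ B v * Valued.v (((a ⟨(l : ℕ) + 1, hl1⟩ : ideleGroup K) : AdeleRing (𝓞 K) K).2 v) := h
        _ ≤ B v * B v ^ (d + 1) := mul_le_mul' le_rfl h2
        _ = B v ^ (d + 1 + 1) := by rw [pow_succ' _ (d + 1)]
  have h := hchain (m - 1 - l) l (by omega)
  rwa [show m - 1 - (l : ℕ) + 1 = m - l from by omega] at h

/-! ### Archimedean decay of `W_φ` at the corner torus points -/

/-- **Single-coordinate archimedean decay at the corner torus points.** Under the hypotheses of the
telescoped decay theorem (`φ` left `GL_{m+1}(K)`-invariant with smooth, continuous, bounded iterated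
archimedean derivatives), for every infinite place `w`, exponent `M` and coordinate `l < m` there is `C ≥ 0`
with `‖W_φ(diag(diag(a) k, 1))‖ · ‖a_{l,w}‖^M ≤ C` for all `a ∈ (𝔸_Kˣ)ᵐ`, `k ∈ K_m` (the archimedean Iwasawa
data of the corner point, `exists_toMixed_glCorner_torusPoint`: radii `‖a_{i,w}‖` and `1` in the last row).
[cite: CogdellAnalyticTheory2004, Thm. 1.1 and §2.3] -/
theorem norm_whittakerDepth_glCorner_mul_pow_le {φ : GL (Fin (m + 1)) (AdeleRing (𝓞 K) K) → ℂ}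
    (hφK : ∀ (γ₀ : GL (Fin (m + 1)) K) (x : GL (Fin (m + 1)) (AdeleRing (𝓞 K) K)),
      φ (Matrix.GeneralLinearGroup.map (algebraMap K (AdeleRing (𝓞 K) K)) γ₀ * x) = φ x)
    (hs : ∀ l : List (archGroupGL (m + 1) K).lie, IsArchSmooth (glArch (m + 1) K) (iterLieDeriv (glArch (m + 1) K) l φ))
    (hc : ∀ l : List (archGroupGL (m + 1) K).lie, Continuous (iterLieDeriv (glArch (m + 1) K) l φ))
    (hb : ∀ l : List (archGroupGL (m + 1) K).lie, ∃ C : ℝ, ∀ z, ‖iterLieDeriv (glArch (m + 1) K) l φ z‖ ≤ C)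
    (w : InfinitePlace K) (M : ℕ) (l : Fin m) :
    ∃ C : ℝ, 0 ≤ C ∧ ∀ (a : Fin m → ideleGroup K) (k : ↥(maximalCompactAdelic m K)),
      ‖whittakerDepth 0 φ (glCorner (AdeleRing (𝓞 K) K) (Nat.le_succ m) (torusPoint m K (a, k)))‖ *
        ‖((a l : ideleGroup K) : AdeleRing (𝓞 K) K).1 w‖ ^ M ≤ C := by
  obtain ⟨C, hC0, hC⟩ :=
    Literature.NumberTheory.Automorphic.exists_norm_whittakerDepth_zero_mul_pow_le hφK hs hc hb w M (Fin.castSucc l)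
  refine ⟨C, hC0, fun a k => ?_⟩
  obtain ⟨dd, κ, hκ, htm, hdd⟩ := exists_toMixed_glCorner_torusPoint a k.2
  set r : Fin (m + 1) → ℝ := Fin.snoc (fun i => ‖((a i : ideleGroup K) : AdeleRing (𝓞 K) K).1 w‖) 1 with hr
  have hr_last : r (Fin.last m) = 1 := by rw [hr, Fin.snoc_last]
  have hr_cast : ∀ i : Fin m, r (Fin.castSucc i) = ‖((a i : ideleGroup K) : AdeleRing (𝓞 K) K).1 w‖ := fun i => by
    rw [hr, Fin.snoc_castSucc]
  have hrpos : ∀ i, 0 < r i := by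
    intro i
    induction i using Fin.lastCases with
    | last => rw [hr_last]; exact one_pos
    | cast j =>
      rw [hr_cast, ← norm_mixedSpaceEvalAt_archUnit (a j) w]
      exact norm_pos_iff.2 (mixedSpaceEvalAt_unit_ne_zero _ w)
  have hddr : ∀ i, mixedSpaceEvalAt K w (dd i : mixedSpace K) = (r i : ℂ) := by
    intro i
    induction i using Fin.lastCases with
    | last => rw [(hdd w).2, hr_last, Complex.ofReal_one]
    | cast j => rw [(hdd w).1 j, hr_cast]
  have h := hC _ dd r κ hrpos hddr hκ htm
  have e2 : r ⟨m + 1 - 1, Nat.sub_lt (Fin.castSucc l).pos Nat.one_pos⟩ = 1 := hr_last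
  rw [hr_cast, e2, one_pow, mul_one] at h
  exact h

/-- **Product archimedean decay at the corner torus points**: for `0 < m` and every `M` there is `C ≥ 0`
with `‖W_φ(diag(diag(a) k, 1))‖ · (∏_{l,w} max(1, ‖a_{l,w}‖))^M ≤ C` (apply the single-coordinate decay
with exponent `N M`, `N = m · #{w}`, in the coordinate of largest archimedean size, and the trivial bound
`‖W_φ‖ ≤ sup ‖φ‖` when all sizes are `≤ 1`). [cite: CogdellAnalyticTheory2004, Thm. 1.1 and §2.3] -/
theorem norm_whittakerDepth_glCorner_mul_prod_pow_le (hm : 0 < m) {φ : GL (Fin (m + 1)) (AdeleRing (𝓞 K) K) → ℂ}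
    (hφK : ∀ (γ₀ : GL (Fin (m + 1)) K) (x : GL (Fin (m + 1)) (AdeleRing (𝓞 K) K)),
      φ (Matrix.GeneralLinearGroup.map (algebraMap K (AdeleRing (𝓞 K) K)) γ₀ * x) = φ x)
    (hs : ∀ l : List (archGroupGL (m + 1) K).lie, IsArchSmooth (glArch (m + 1) K) (iterLieDeriv (glArch (m + 1) K) l φ))
    (hc : ∀ l : List (archGroupGL (m + 1) K).lie, Continuous (iterLieDeriv (glArch (m + 1) K) l φ))
    (hb : ∀ l : List (archGroupGL (m + 1) K).lie, ∃ C : ℝ, ∀ z, ‖iterLieDeriv (glArch (m + 1) K) l φ z‖ ≤ C)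
    (M : ℕ) :
    ∃ C : ℝ, 0 ≤ C ∧ ∀ (a : Fin m → ideleGroup K) (k : ↥(maximalCompactAdelic m K)),
      ‖whittakerDepth 0 φ (glCorner (AdeleRing (𝓞 K) K) (Nat.le_succ m) (torusPoint m K (a, k)))‖ *
        (∏ l : Fin m, ∏ w : InfinitePlace K, max 1 ‖((a l : ideleGroup K) : AdeleRing (𝓞 K) K).1 w‖) ^ M ≤ C := by
  set N : ℕ := m * Fintype.card (InfinitePlace K) with hN
  choose Cd hCd0 hCd using fun (w : InfinitePlace K) (l : Fin m) =>
    norm_whittakerDepth_glCorner_mul_pow_le hφK hs hc hb w (N * M) l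
  obtain ⟨B, hB⟩ := hb []
  set C₁ : ℝ := ∑ w, ∑ l, Cd w l with hC₁
  have hC₁0 : 0 ≤ C₁ := Finset.sum_nonneg fun w _ => Finset.sum_nonneg fun l _ => hCd0 w l
  have hCdle : ∀ w l, Cd w l ≤ C₁ := fun w l =>
    (Finset.single_le_sum (f := fun l' => Cd w l') (fun l' _ => hCd0 w l') (Finset.mem_univ l)).trans
      (Finset.single_le_sum (f := fun w' => ∑ l', Cd w' l') (fun w' _ => Finset.sum_nonneg fun l' _ => hCd0 w' l')
        (Finset.mem_univ w))
  refine ⟨max B 0 + C₁, by positivity, fun a k => ?_⟩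
  haveI : Nonempty (Fin m) := ⟨⟨0, hm⟩⟩
  set f : Fin m × InfinitePlace K → ℝ := fun p => ‖((a p.1 : ideleGroup K) : AdeleRing (𝓞 K) K).1 p.2‖ with hf
  obtain ⟨p, -, hp⟩ := Finset.exists_max_image Finset.univ f Finset.univ_nonempty
  set W : ℝ := ‖whittakerDepth 0 φ (glCorner (AdeleRing (𝓞 K) K) (Nat.le_succ m) (torusPoint m K (a, k)))‖ with hWdef
  have hW0 : 0 ≤ W := norm_nonneg _
  have hWB : W ≤ max B 0 := (norm_whittakerDepth_le (fun z => hB z) 0 _).trans (le_max_left _ _)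
  have hprod0 : 0 ≤ ∏ l : Fin m, ∏ w : InfinitePlace K, max 1 ‖((a l : ideleGroup K) : AdeleRing (𝓞 K) K).1 w‖ :=
    Finset.prod_nonneg fun l _ => Finset.prod_nonneg fun w _ => le_trans zero_le_one (le_max_left _ _)
  have hprod : (∏ l : Fin m, ∏ w : InfinitePlace K, max 1 ‖((a l : ideleGroup K) : AdeleRing (𝓞 K) K).1 w‖) ≤
      (max 1 (f p)) ^ N := by
    calc (∏ l : Fin m, ∏ w : InfinitePlace K, max 1 ‖((a l : ideleGroup K) : AdeleRing (𝓞 K) K).1 w‖)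
        ≤ ∏ _l : Fin m, ∏ _w : InfinitePlace K, max 1 (f p) :=
          Finset.prod_le_prod (fun l _ => Finset.prod_nonneg fun w _ => le_trans zero_le_one (le_max_left _ _))
            fun l _ => Finset.prod_le_prod (fun w _ => le_trans zero_le_one (le_max_left _ _))
              fun w _ => max_le_max le_rfl (hp (l, w) (Finset.mem_univ _))
      _ = (max 1 (f p)) ^ N := by
          rw [Finset.prod_const, Finset.prod_const, Finset.card_univ, Finset.card_univ, Fintype.card_fin, ← pow_mul,
            hN, mul_comm]
  have h1 : W * (∏ l : Fin m, ∏ w : InfinitePlace K, max 1 ‖((a l : ideleGroup K) : AdeleRing (𝓞 K) K).1 w‖) ^ M ≤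
      W * (max 1 (f p)) ^ (N * M) := by
    rw [pow_mul]
    exact mul_le_mul_of_nonneg_left (pow_le_pow_left₀ hprod0 hprod M) hW0
  refine h1.trans ?_
  rcases le_or_gt (f p) 1 with hρ | hρ
  · rw [max_eq_left hρ, one_pow, mul_one]
    exact hWB.trans (le_add_of_nonneg_right hC₁0)
  · rw [max_eq_right hρ.le]
    exact (hCd p.2 p.1 a k).trans ((hCdle p.2 p.1).trans (le_add_of_nonneg_left (le_max_right _ _)))

/-! ### The majorant for an `A_G`-invariant honest cusp form -/

/-- **The corner majorant of an `A_G`-invariant honest cusp form on `GL_{m+1}(𝔸_K)`** (`0 < m`). There are a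
finite set `S` of finite places and bounds `R_v ∈ ℤₘ₀`, `R_v ≥ 1`, `R_v = 1` off `S`, such that
(i) **finite support**: `W_φ(diag(diag(a) k, 1)) ≠ 0` forces `|a_{l,v}|_v ≤ R_v` for all `l < m` and all
finite `v`; (ii) **archimedean decay**: for every `M` there is `C ≥ 0` with
`‖W_φ(diag(diag(a) k, 1))‖ ≤ C ∏_{l<m} ∏_{w|∞} min(1, ‖a_{l,w}‖^{-M})` for all `a ∈ (𝔸_Kˣ)ᵐ`, `k ∈ K_m` — the gauge
estimates of the unfolded `GL_{m+1} × GL_m` integral (left `GL_{m+1}(K)`-invariance, a principal congruence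
level `IsCuspFormGL.exists_principalCongruenceLevel`, Tate's bound `exists_finset_bound_adeleAddCharAt`, bounded
smooth derivatives `IsCuspFormGL.isArchSmooth_continuous_bounded_iterLieDeriv_of_center'`).
[cite: CogdellAnalyticTheory2004, §2.3] -/
theorem corner_majorant (hm : 0 < m) {φ : GL (Fin (m + 1)) (AdeleRing (𝓞 K) K) → ℂ}
    (hφ : IsCuspFormGL (m + 1) K (isCompact_glFiniteIntegralLevel_holds (m + 1) K) φ)
    (hA : ∀ z ∈ (AdelicGroupData.gl (m + 1) K).center', ∀ g : (AdelicGroupData.gl (m + 1) K).Adelic, φ (z * g) = φ g) :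
    ∃ (S : Finset (HeightOneSpectrum (𝓞 K))) (R : HeightOneSpectrum (𝓞 K) → WithZero (Multiplicative ℤ)),
      (∀ v, 1 ≤ R v) ∧ (∀ v ∉ S, R v = 1) ∧
      (∀ (a : Fin m → ideleGroup K) (k : ↥(maximalCompactAdelic m K)),
        whittakerDepth 0 φ (glCorner (AdeleRing (𝓞 K) K) (Nat.le_succ m) (torusPoint m K (a, k))) ≠ 0 →
        ∀ (l : Fin m) (v : HeightOneSpectrum (𝓞 K)), Valued.v (((a l : ideleGroup K) : AdeleRing (𝓞 K) K).2 v) ≤ R v) ∧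
      ∀ M : ℕ, ∃ C : ℝ, 0 ≤ C ∧ ∀ (a : Fin m → ideleGroup K) (k : ↥(maximalCompactAdelic m K)),
        ‖whittakerDepth 0 φ (glCorner (AdeleRing (𝓞 K) K) (Nat.le_succ m) (torusPoint m K (a, k)))‖ ≤
          C * ∏ l : Fin m, ∏ w : InfinitePlace K, ((max 1 ‖((a l : ideleGroup K) : AdeleRing (𝓞 K) K).1 w‖) ^ M)⁻¹ := by
  have hφK : ∀ (γ₀ : GL (Fin (m + 1)) K) (x : GL (Fin (m + 1)) (AdeleRing (𝓞 K) K)),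
      φ (Matrix.GeneralLinearGroup.map (algebraMap K (AdeleRing (𝓞 K) K)) γ₀ * x) = φ x :=
    fun γ₀ x => hφ.1.leftInvariant _ (show _ ∈ rationalPointsGL (m + 1) K from ⟨γ₀, rfl⟩) x
  obtain ⟨𝔫, h𝔫, hU⟩ := hφ.exists_principalCongruenceLevel
  have hφU : ∀ x, ∀ u ∈ principalCongruenceLevel (m + 1) K 𝔫, φ (x * u) = φ x := fun x u hu => hU u hu x
  obtain ⟨S, B, hB1, hBS, hB⟩ := exists_finset_bound_adeleAddCharAt K h𝔫
  have hpack := fun l => hφ.isArchSmooth_continuous_bounded_iterLieDeriv_of_center' hA l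
  refine ⟨S, fun v => B v ^ m, fun v => one_le_pow_of_one_le' (hB1 v) m, fun v hv => by show B v ^ m = 1; rw [hBS v hv, one_pow],
    fun a k hW l v => ?_, fun M => ?_⟩
  · exact (valued_le_pow_of_whittakerDepth_glCorner_ne_zero hφK hφU hB hW v l).trans
      (pow_le_pow_right' (hB1 v) (Nat.sub_le m l))
  · obtain ⟨C, hC0, hC⟩ := norm_whittakerDepth_glCorner_mul_prod_pow_le hm hφK (fun l => (hpack l).2.2.1)
      (fun l => (hpack l).2.2.2.1) (fun l => (hpack l).2.2.2.2) M
    refine ⟨C, hC0, fun a k => ?_⟩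
    have hpos : 0 < (∏ l : Fin m, ∏ w : InfinitePlace K, max 1 ‖((a l : ideleGroup K) : AdeleRing (𝓞 K) K).1 w‖) ^ M :=
      pow_pos (Finset.prod_pos fun l _ => Finset.prod_pos fun w _ => lt_of_lt_of_le one_pos (le_max_left _ _)) M
    have h := hC a k
    rw [← le_div_iff₀ hpos] at h
    refine h.trans (le_of_eq ?_)
    rw [div_eq_mul_inv, ← Finset.prod_pow, ← Finset.prod_inv_distrib]
    congr 1
    refine Finset.prod_congr rfl fun l _ => ?_
    rw [← Finset.prod_pow, ← Finset.prod_inv_distrib]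



/-! ### The registered sub-goal -/

/-- **SUB-GOAL (W-Ac, part 1/4) — the corner majorant of an `A_G`-invariant honest cusp form on
`GL_{m+1}(𝔸_K)`**, the `∀`-form of `corner_majorant` (registered on stmt-Langlands-13622 so that this helper
file lands `--supports`; consumed by part 4, `…PairLBoundaryJSCornerAbsConvergence.stub_corner_abs_convergence`).
[cite: CogdellAnalyticTheory2004, §2.3] -/
theorem stub_corner_majorant :
    ∀ {m : ℕ} {K : Type} [Field K] [NumberField K], 0 < m →
      ∀ {φ : GL (Fin (m + 1)) (AdeleRing (𝓞 K) K) → ℂ},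
      IsCuspFormGL (m + 1) K (isCompact_glFiniteIntegralLevel_holds (m + 1) K) φ →
      (∀ z ∈ (AdelicGroupData.gl (m + 1) K).center', ∀ g : (AdelicGroupData.gl (m + 1) K).Adelic, φ (z * g) = φ g) →
      ∃ (S : Finset (HeightOneSpectrum (𝓞 K))) (R : HeightOneSpectrum (𝓞 K) → WithZero (Multiplicative ℤ)),
        (∀ v, 1 ≤ R v) ∧ (∀ v ∉ S, R v = 1) ∧
        (∀ (a : Fin m → ideleGroup K) (k : ↥(maximalCompactAdelic m K)),
          whittakerDepth 0 φ (glCorner (AdeleRing (𝓞 K) K) (Nat.le_succ m) (torusPoint m K (a, k))) ≠ 0 →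
          ∀ (l : Fin m) (v : HeightOneSpectrum (𝓞 K)), Valued.v (((a l : ideleGroup K) : AdeleRing (𝓞 K) K).2 v) ≤ R v) ∧
        ∀ M : ℕ, ∃ C : ℝ, 0 ≤ C ∧ ∀ (a : Fin m → ideleGroup K) (k : ↥(maximalCompactAdelic m K)),
          ‖whittakerDepth 0 φ (glCorner (AdeleRing (𝓞 K) K) (Nat.le_succ m) (torusPoint m K (a, k)))‖ ≤
            C * ∏ l : Fin m, ∏ w : InfinitePlace K, ((max 1 ‖((a l : ideleGroup K) : AdeleRing (𝓞 K) K).1 w‖) ^ M)⁻¹ := by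
  intro m K _ _ hm φ hφ hA
  exact corner_majorant hm hφ hA

end Summit.Langlands.Langlands.Theorems.CornerAbsMajorant

end
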